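import Summits.QuantumFields.YangMills.Theorems.UnitScaleTiltProp7NestedMeanParallelLiftInhabited
import Summits.QuantumFields.YangMills.Theorems.UnitScaleTiltProp7SymAvgGLSmallOfRegPr
import HarnessLib

/-!
# Route `UnitScaleTilt`, crux K1 child «MinimiserStabilityRegPr» (stmt-QuantumFields-19200), skeleton v10, stub `stub_existenceMinimalOrbit` (EX), route (α),
# DENSITY line (★★OWNER RULING g28-№8 (B)) — **(D5b) THE BRIDGE ROW `hIrrLift` OF THE DENSITY KNIT DISCHARGED FOR THE `hLift` TEXT OF RECORD: over an
# IRREDUCIBLE datum `V` (every `V`-parallel `M₂(ℂ)`-section scalar) EVERY printed-regular point `U₀` of the fibre `𝔅_k(V)` carries the lift** — the averaged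
# background `Ū₀ = Ū₀♭⁽ᴷ⁻ⁿ⁾` IS `V` read on the `K`-th tower (✓`descendTo_eq_fieldShift_emlIterU_of_regPr`), so `Ū₀`-parallel sections are `V`-parallel sections
# transported along `siteShift`, hence scalar, and ✓p671081 `hLift_of_onlyScalarParallel` lifts them.

Cell `ym3-torus`, width seat `ym3-torus-px10` (gen 3).  THEOREMS ONLY (0 `def`, 0 `sorry`).  `--supports stmt-QuantumFields-19200 --as helper`,
count-neutral.  YM₃ on T³ is a ladder rung (R3), not the Clay problem; nothing here claims the stub, the crux, d = 4 or the mass gap.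

WHAT IS PROVED (sorry-free, no definition; ns `…Theorems.Prop7StubEXOfDensityLift`):
* §1 `onlyScalarParallel_emlIterU_of_irreducible` (member level) — `U₀ ∈ 𝔅_k(V)`, `RegPr F n K ε₀ U₀`, `10⁷L³ε₀ ≤ 1`, `V` irreducible (intertwining form
  `cf(b₋)·V(b) = V(b)·cf(b₊) ⇒ cf` scalar) ⇒ every `Ū₀`-parallel section of the `(K−n)`-th level (conjugation form of ✓p665243's binder) is scalar.
* §2 ★★ `irrLift_T3 (hL : 1 < L) (hB₃ : 0 < B₃)` — the hypothesis `hIrrLift` of ✓-candidate `Prop7StubEXOfDensity.existenceMinimalOrbit_of_CminG_cov_irrLift_localSurj` with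
  `Lift i U₀ :=` THE TEXT OF RECORD (HOME `ym-ust-19200-w2/g6/HLIFT-ANTECEDENT-OF-RECORD.w2g6.txt`, = ✓`hHZ_of_parallelLift`'s binder at member letters), window
  `aI := 1∕(10⁷·L⁶·B₃)` (so that `10⁷L³·(L³B₃ε₁) ≤ 1`).

HONEST SCOPE.  Bookkeeping over ✓p671081 and the descent dictionary; nothing of [Balaban1985Variational] is asserted; no stub ∕ crux statement is advanced; YM₃ on
T³ = rung R3 — not d = 4, not infinite volume, not a mass gap, not Clay.

References: T. Bałaban, CMP 99 (1985) 389–434 [Balaban1985BackgroundPropagators] ((3.19)–(3.21) pp.393–394); CMP 102 (1985) 277–309 [Balaban1985Variational] ((3), (6)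
p.278); CMP 109 (1987) 249–301 [Balaban1987RG1] ((0.4) p.253).
-/

set_option autoImplicit false

noncomputable section

open scoped BigOperators Matrix.Norms.L2Operator

namespace Summit.QuantumFields.YangMills.Theorems.Prop7StubEXOfDensityLift

open Literature.MathematicalPhysics.QuantumFieldTheory.Balaban1983to89
open Literature.MathematicalPhysics.QuantumFieldTheory.Balaban1983to89.T3ContinuumYM3Torus
open T3PrintedRegularMinimiser (RegPr)
open T3Thm1Carrier (Idx)
open T3ConstrainedMinimiser (fibre)
open T3TiltDescent (descendTo)
open T3LevelShift (fieldShift siteShift bondShift fieldShift_apply bondShift_src bondShift_tgt)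
open T3SectALandauChart (bgUnits)
open B10Eq27TorusAxialLog (unitsField toUField val_unitsField)
open B15DeterminingSets (embIter)
open Summit.QuantumFields.YangMills.Theorems.Prop8Chart (emlIterU)
open Summit.QuantumFields.YangMills.Theorems.Prop7SymAvgGLSmallOfRegPr (descendTo_eq_fieldShift_emlIterU_of_regPr)
open Summit.QuantumFields.YangMills.Theorems.Prop7NestedMeanParallelLift (hLift_of_onlyScalarParallel)

/-! ## §1 Over an irreducible datum the averaged background has only scalar parallel sections -/

section Member

variable (F : T3Family) {n K : ℕ} (h : n ≤ K)

/-- **`Ū₀`-PARALLEL SECTIONS ARE SCALAR OVER AN IRREDUCIBLE DATUM**: for `U₀ ∈ 𝔅_k(V) ∩ 𝔘_k(ε₀)` (`10⁷L³ε₀ ≤ 1`) the averaged background of the `(K−n)`-th level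
is `V` transported along the level identification (✓`descendTo_eq_fieldShift_emlIterU_of_regPr`), so a section `cf` with `cf(e₋) = Ū₀(e)·cf(e₊)·Ū₀(e)⁻¹`
on every bond is, read through `siteShift`, a `V`-parallel section — scalar by irreducibility of `V`.
[cite: Balaban1985BackgroundPropagators, (3.21) p.394; Balaban1987RG1, (0.4) p.253] -/
theorem onlyScalarParallel_emlIterU_of_irreducible {ε₀ : ℝ} (hε₀ : 0 < ε₀) (hε : 10 ^ 7 * (F.L : ℝ) ^ 3 * ε₀ ≤ 1)
    {V : GaugeField (F.P n) 0 (Matrix.specialUnitaryGroup (Fin 2) ℂ)} {U₀ : GaugeField (F.P K) 0 (Matrix.specialUnitaryGroup (Fin 2) ℂ)}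
    (hfib : U₀ ∈ fibre F T3UnitLawDensityEML.ℰp n K h V) (hreg : RegPr F n K ε₀ U₀)
    (hIrr : ∀ cf : Site (F.P n) 0 → Matrix (Fin 2) (Fin 2) ℂ,
      (∀ e : PBond (F.P n) 0, cf e.src * ((V e : Matrix.specialUnitaryGroup (Fin 2) ℂ) : Matrix (Fin 2) (Fin 2) ℂ) =
        ((V e : Matrix.specialUnitaryGroup (Fin 2) ℂ) : Matrix (Fin 2) (Fin 2) ℂ) * cf e.tgt) →
      ∃ z : ℂ, ∀ y : Site (F.P n) 0, cf y = z • (1 : Matrix (Fin 2) (Fin 2) ℂ)) :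
    ∀ cf : Site (F.P K) (K - n) → Matrix (Fin 2) (Fin 2) ℂ,
      (∀ e : PBond (F.P K) (K - n), cf e.src = ((emlIterU (K - n) (bgUnits F K U₀) e : (Matrix (Fin 2) (Fin 2) ℂ)ˣ) : Matrix (Fin 2) (Fin 2) ℂ) * cf e.tgt *
        (((emlIterU (K - n) (bgUnits F K U₀) e)⁻¹ : (Matrix (Fin 2) (Fin 2) ℂ)ˣ) : Matrix (Fin 2) (Fin 2) ℂ)) →
      ∃ z : ℂ, ∀ y, cf y = z • (1 : Matrix (Fin 2) (Fin 2) ℂ) := by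
  intro cf hpar
  -- the level identification `(F.P n) level 0 ≃ (F.P K) level K − n`
  have hs : (F.PP F.m n).sitesPerDir 0 = (F.PP F.m K).sitesPerDir (K - n) :=
    F.sitesPerDir_eq (m := F.m) (K := n) (j := 0) (m' := F.m) (K' := K) (j' := K - n) (by omega)
  -- the dictionary: `V♭ = fieldShift hs Ū₀`
  have hdict : unitsField (toUField V) = fieldShift hs (emlIterU (K - n) (bgUnits F K U₀)) := by
    have hV : descendTo F T3UnitLawDensityEML.ℰp n K h U₀ = V := hfib
    rw [← hV]
    exact descendTo_eq_fieldShift_emlIterU_of_regPr F h hε₀ hε hreg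
  have hVe : ∀ c : PBond (F.P n) 0, ((V c : Matrix.specialUnitaryGroup (Fin 2) ℂ) : Matrix (Fin 2) (Fin 2) ℂ) =
      ((emlIterU (K - n) (bgUnits F K U₀) (bondShift hs c) : (Matrix (Fin 2) (Fin 2) ℂ)ˣ) : Matrix (Fin 2) (Fin 2) ℂ) := by
    intro c
    have := congrFun hdict c
    rw [fieldShift_apply] at this
    exact congrArg Units.val this
  -- the pulled-back section is `V`-parallel
  set cf' : Site (F.P n) 0 → Matrix (Fin 2) (Fin 2) ℂ := fun y => cf (siteShift hs y) with hcf'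
  have hpar' : ∀ c : PBond (F.P n) 0, cf' c.src * ((V c : Matrix.specialUnitaryGroup (Fin 2) ℂ) : Matrix (Fin 2) (Fin 2) ℂ) =
      ((V c : Matrix.specialUnitaryGroup (Fin 2) ℂ) : Matrix (Fin 2) (Fin 2) ℂ) * cf' c.tgt := by
    intro c
    have he : cf (siteShift hs c.src) = ((emlIterU (K - n) (bgUnits F K U₀) (bondShift hs c) : (Matrix (Fin 2) (Fin 2) ℂ)ˣ) : Matrix (Fin 2) (Fin 2) ℂ) *
        cf ((siteShift hs c.src).shift c.dir) * (((emlIterU (K - n) (bgUnits F K U₀) (bondShift hs c))⁻¹ : (Matrix (Fin 2) (Fin 2) ℂ)ˣ) : Matrix (Fin 2) (Fin 2) ℂ) :=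
      hpar (bondShift hs c)
    have htgt : (siteShift hs c.src).shift c.dir = siteShift hs c.tgt := (T3LevelShift.siteShift_shift hs c.src c.dir).symm
    rw [htgt] at he
    show cf (siteShift hs c.src) * _ = _ * cf (siteShift hs c.tgt)
    rw [hVe c, he, mul_assoc, mul_assoc, Units.inv_mul, mul_one]
  obtain ⟨z, hz⟩ := hIrr cf' hpar'
  refine ⟨z, fun y => ?_⟩
  have hy := hz ((siteShift hs).symm y)
  simpa only [hcf', Equiv.apply_symm_apply] using hy

end Member

/-! ## §2 ★★ The bridge row of the DENSITY knit for the `hLift` text of record -/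

/-- ★★ **`hIrrLift` FOR THE TEXT OF RECORD**: with `aI := 1∕(10⁷L⁶B₃)`, for every member, `0 < ε₁ ≤ aI`, every IRREDUCIBLE datum `V` and every background
`U₀ ∈ 𝔘_k(L³B₃ε₁) ∩ 𝔅_k(V)`: the lift row `hLift U₀` of ✓`hHZ_of_parallelLift` (every `Ū₀`-parallel coarse section is the restriction along `embIter (K−n)` of a
`U₀`-parallel fine section) HOLDS — §1 + ✓p671081 `hLift_of_onlyScalarParallel`. [cite: Balaban1985BackgroundPropagators, (3.19)-(3.21) pp.393-394; Balaban1985Variational, (6) p.278] -/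
theorem irrLift_T3 {L : ℕ} (hL : 1 < L) {B₃ : ℝ} (hB₃ : 0 < B₃) :
    ∃ aI : ℝ, 0 < aI ∧ ∀ (i : Idx L) (ε₁ : ℝ), 0 < ε₁ → ε₁ ≤ aI →
      ∀ (V : GaugeField (i.1.1.P i.1.2.1) 0 (Matrix.specialUnitaryGroup (Fin 2) ℂ)) (U₀ : GaugeField (i.1.1.P i.1.2.2) 0 (Matrix.specialUnitaryGroup (Fin 2) ℂ)),
        (∀ cf : Site (i.1.1.P i.1.2.1) 0 → Matrix (Fin 2) (Fin 2) ℂ,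
            (∀ e : PBond (i.1.1.P i.1.2.1) 0, cf e.src * ((V e : Matrix.specialUnitaryGroup (Fin 2) ℂ) : Matrix (Fin 2) (Fin 2) ℂ) =
              ((V e : Matrix.specialUnitaryGroup (Fin 2) ℂ) : Matrix (Fin 2) (Fin 2) ℂ) * cf e.tgt) →
            ∃ z : ℂ, ∀ y : Site (i.1.1.P i.1.2.1) 0, cf y = z • (1 : Matrix (Fin 2) (Fin 2) ℂ)) →
        PlaqSmall ε₁ V → RegPr i.1.1 i.1.2.1 i.1.2.2 ((L : ℝ) ^ 3 * B₃ * ε₁) U₀ → U₀ ∈ fibre i.1.1 T3UnitLawDensityEML.ℰp i.1.2.1 i.1.2.2 i.2.2.le V →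
        (∀ cf : Site (i.1.1.P i.1.2.2) (i.1.2.2 - i.1.2.1) → Matrix (Fin 2) (Fin 2) ℂ,
          (∀ e' : PBond (i.1.1.P i.1.2.2) (i.1.2.2 - i.1.2.1), cf e'.src = ((emlIterU (i.1.2.2 - i.1.2.1) (bgUnits i.1.1 i.1.2.2 U₀) e' : (Matrix (Fin 2) (Fin 2) ℂ)ˣ) : Matrix (Fin 2) (Fin 2) ℂ) * cf e'.tgt *
            (((emlIterU (i.1.2.2 - i.1.2.1) (bgUnits i.1.1 i.1.2.2 U₀) e')⁻¹ : (Matrix (Fin 2) (Fin 2) ℂ)ˣ) : Matrix (Fin 2) (Fin 2) ℂ)) →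
          ∃ l₀ : Site (i.1.1.P i.1.2.2) 0 → Matrix (Fin 2) (Fin 2) ℂ,
            (∀ b' : PBond (i.1.1.P i.1.2.2) 0, l₀ b'.src = ((bgUnits i.1.1 i.1.2.2 U₀ b' : (Matrix (Fin 2) (Fin 2) ℂ)ˣ) : Matrix (Fin 2) (Fin 2) ℂ) * l₀ b'.tgt * (((bgUnits i.1.1 i.1.2.2 U₀ b')⁻¹ : (Matrix (Fin 2) (Fin 2) ℂ)ˣ) : Matrix (Fin 2) (Fin 2) ℂ)) ∧
            ∀ y : Site (i.1.1.P i.1.2.2) (i.1.2.2 - i.1.2.1), l₀ (embIter (i.1.2.2 - i.1.2.1) y) = cf y) := by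
  have hL0 : (0 : ℝ) < (L : ℝ) := by exact_mod_cast (lt_trans zero_lt_one hL)
  have hK : (0 : ℝ) < 10 ^ 7 * (L : ℝ) ^ 6 * B₃ := by positivity
  refine ⟨1 / (10 ^ 7 * (L : ℝ) ^ 6 * B₃), by positivity, ?_⟩
  intro i ε₁ hε₁ hε₁a V U₀ hIrr _hV hreg hfib
  obtain ⟨⟨F, n, K⟩, hF, hnK⟩ := i
  -- the regularity window of the dictionary: `10⁷·L³·(L³B₃ε₁) ≤ 1`
  have hε₀ : 0 < (L : ℝ) ^ 3 * B₃ * ε₁ := by positivity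
  have hwin : 10 ^ 7 * (F.L : ℝ) ^ 3 * ((L : ℝ) ^ 3 * B₃ * ε₁) ≤ 1 := by
    have hF' : (F.L : ℝ) = L := by exact_mod_cast hF
    rw [hF']
    have := (le_div_iff₀ hK).1 hε₁a
    nlinarith
  exact hLift_of_onlyScalarParallel F U₀ (onlyScalarParallel_emlIterU_of_irreducible F hnK.le hε₀ hwin hfib hreg hIrr)

end Summit.QuantumFields.YangMills.Theorems.Prop7StubEXOfDensityLift

end
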